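import Summits.MatrixMultiplication.MatrixMultiplication.Theses.ApproximationProfile

/-!
# Birth skeleton (BC3) for crux `Softness` — stmt-MatrixMultiplication-5015

Route `route-MatrixMultiplication-ApproximationProfile` (rank 3 crux; sole route wanting it).  The crux:

  `Softness : ∃ η ∈ (0,1), ∀ ε > 0, ∃ C N, ∀ n ≥ N, ∃ S, R(S) ≤ C·n^{2+ε} ∧ ‖⟨n,n,n⟩ − S‖² ≤ η·n³`

("`ω^ap(η) ≤ 2` for ONE `η`": coherent approximate matrix multiplication at quadratic rank cost).

LINE `birth` = the route's own foreseen two-layer split (route header, TWO-LAYER PLAN: "Softness ⇐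
GroupSoftness (glue = GroupSoftnessGlue, provable now)"), typed as a skeleton.  The one known COHERENT
source of low-rank approximants of `⟨n,n,n⟩` is the Cohn–Umans embedding with the triple-product
property RELAXED: for any finite group `G` and any three `n`-tuples `s t u : Fin n → G`, pull the
structure tensor `groupTensor ℂ G` (`[x·y = z]`) back along the Cohn–Umans coordinate maps
`b = (κ,μ) ↦ s_κ⁻¹ t_μ`, `c = (μ,ν) ↦ t_μ⁻¹ u_ν`, `a = (κ,ν) ↦ s_κ⁻¹ u_ν`.  The pullback `S_{s,t,u}` is a
`0/1` tensor of the format of `⟨n,n,n⟩`, it is a restriction of `groupTensor ℂ G` (so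
`R(S_{s,t,u}) ≤ R(ℂ[G])`, `tensorRestrictsTo_precomp` + `TensorRestrictsTo.tensorRank_le`), it has a
`1` wherever `⟨n,n,n⟩` has one (the "trivial" solutions `κ'=κ, μ'=μ, ν'=ν` of
`(s_{κ'}⁻¹ t_μ)(t_{μ'}⁻¹ u_{ν'}) = s_κ⁻¹ u_ν` always hold), and its only other entries are `1`s at the
NON-trivial solutions of that equation; hence `‖⟨n,n,n⟩ − S_{s,t,u}‖²` = the number of non-trivial
solutions (Cohn–Umans 2003, Thm. 2.3 and its proof, with the TPP hypothesis dropped: TPP is exactly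
"no non-trivial solutions", where the pullback IS `⟨n,n,n⟩`).  So Softness follows from a family of
groups `G_n` with cheap group algebra `R(ℂ[G_n]) ≤ C_ε n^{2+ε}` carrying `n`-tuples with at most
`η n³` non-trivial solutions — which is the route's crux `GroupSoftness` (item
stmt-MatrixMultiplication-5016, rank 4) verbatim.

STUBS (2; each a genuine lemma of the line, neither a restatement of `Softness` or of `ω = 2`):
* `stub_nearTppRestriction` — the TPP-free Cohn–Umans embedding with its error count (the
  mathematical content of the route's support item `GroupSoftnessGlue`, stmt-MatrixMultiplication-5023,
  stated WITHOUT reference to `Softness`): size M, provable now (refuter g40-12 / route review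
  2026-08-15: conventions `a=(κ,ν)`, `b=(κ,μ)`, `c=(μ,ν)` verified against `matMulTensor` and
  `groupTensor z x y = [x*y = z]`).  Leans on: `tensorRestrictsTo_precomp`,
  `TensorRestrictsTo.tensorRank_le` (TensorRestrictionRank.lean), `groupTensor_apply`, `matMulTensor`;
  the sum-to-card step is `Finset.sum_boole`-type bookkeeping over `(Fin n × Fin n)³`.
* `stub_groupSoftness` — the route crux `GroupSoftness` BY NAME (item stmt-MatrixMultiplication-5016,
  open-problem; the load-bearing stub): near-TPP `n`-tuples at the packing limit in groups with
  `R(ℂ[G]) = n^{2+o(1)}`.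
ASSEMBLY `Softness_of : NearTppRestriction → GroupSoftness → Softness` (curried, both hypotheses
BY NAME — `NearTppRestriction` is the `def … : Prop` carrying stub 1's text verbatim; sorry-free, axioms
propext / Classical.choice / Quot.sound; pure bookkeeping + one cast): `η, C, N` are those of
`GroupSoftness`; at `n ≥ N` take its `G, s, t, u`, the tensor `S` of stub 1, and chain
`R(S) ≤ R(ℂ[G]) ≤ C n^{2+ε}`, `error ≤ #non-trivial ≤ η n³`.  `Softness_ofStubs : Softness :=
Softness_of stub_nearTppRestriction stub_groupSoftness` is the registered conclusion (the crux decl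
by name, no hypotheses; `#h21_check_skeleton` keys on it — it is enumerated before `Softness_of`).

BC3 RECORD (registrar folder `bc/`, 2026-08-17): `lean check --json` rc 0, errors [], sorries 2 =
the two `stub_*` (zero elsewhere); probes `stub → Softness` and `stub → MatrixMultiplication` by each
of `exact?` / `simpa` / `aesop` (maxHeartbeats 400000) FAIL for both stubs (12/12; `exact?` against the
summit statement times out in `whnf` of `omega ℂ = 2` even at 2·10⁶ heartbeats, the other ten end in
`could not close the goal` / `assumption failed` / `aesop: failed … after exhaustive search`).

REMARK for the GroupSoftness provers (not a stub): the threshold `η < 1` in `GroupSoftness` is not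
load-bearing for this line — if the tuples only achieve `#non-trivial ≤ K n³` for some constant `K`,
the RESCALED pullback `λ·S_{s,t,u}`, `λ = 1/(1+K)`, has the same rank bound and error
`(1−λ)² n³ + λ² K n³ = (K/(1+K))·n³`, i.e. Softness with `η = K/(1+K)`; and random sub-tuples of
size `n/c` divide the ratio `#non-trivial / n³` by at least `c` (a non-trivial solution occupies ≥ 4
distinct index slots), so any constant `K` can be traded for size.

DISPROOF USED: none — no `Disproof.lean` is registered for this crux (`ledger crux ls
stmt-MatrixMultiplication-5015`: no workfiles, 2026-08-17); `ledger negatives --problem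
MatrixMultiplication` (7 entries: S_n threshold/hyperoctahedral subsets, bounded-exponent abelian
Thm B, separable designs, level-two GL₂ designs, exact line/frame designs over finite fields) contains
no statement about approximate/near-TPP tuples or metric approximants — this line meets none of them.
BARRIERS (route header): abelian carriers are excluded outright for stub 2 (Fourier positivity:
≥ n⁶/|G| − n³ non-trivial solutions), so `TricoloredSumFreeBarrier` (bounded-exponent abelian) is
silent; `QuasirandomBarrier` applies in spirit (R(ℂ[G]) ≤ C n^{2+ε} with |G| ≥ n^{2−o(1)} forces all
character degrees n^{o(1)}): the bet of stub 2 is nearly-abelian NON-abelian carriers with η-slack;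
`InfimumNotMinimumBarrier` respected (everything is `∀ ε`, all large `n`).
-/

namespace Summit.MatrixMultiplication.MatrixMultiplication.Cruxes.Softness.Birth

open scoped BigOperators
open Literature.Computability.AlgebraicComplexity

/-! ## 1. Statement of the provable stub (a nameable hypothesis for `Softness_of`) -/

/-- **Statement of stub 1** (`stub_nearTppRestriction`, verbatim the same text): the TPP-free
Cohn–Umans restriction with its error count.  A plain `def … : Prop` so that the curried composition
`Softness_of` can name it as a hypothesis; the registered stub below carries the LITERAL signature
(so that a Theorems-file proof `theorem stub_nearTppRestriction : <this text>` matches it). -/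
def NearTppRestriction : Prop :=
  ∀ (G : Type) [Group G] [Fintype G] [DecidableEq G] (n : ℕ) (s t u : Fin n → G),
    ∃ S : Fin n × Fin n → Fin n × Fin n → Fin n × Fin n → ℂ,
      tensorRank S ≤ tensorRank (groupTensor ℂ G) ∧
      ∑ a, ∑ b, ∑ c, ‖matMulTensor ℂ n n n a b c - S a b c‖ ^ 2 ≤
        ((Finset.univ.filter fun p : (Fin n × Fin n) × (Fin n × Fin n) × (Fin n × Fin n) =>
            (s p.2.1.1)⁻¹ * t p.2.1.2 * ((t p.2.2.1)⁻¹ * u p.2.2.2) = (s p.1.1)⁻¹ * u p.1.2 ∧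
              ¬ (p.1.1 = p.2.1.1 ∧ p.2.1.2 = p.2.2.1 ∧ p.1.2 = p.2.2.2)).card : ℝ)

/-! ## 2. The two registered stubs -/

/-- **Stub 1 (near-TPP restriction = Cohn–Umans 2003, Thm. 2.3 with the TPP hypothesis dropped).**
For every finite group `G`, every `n` and all `n`-tuples `s t u : Fin n → G` there is a tensor `S` in
the format of `⟨n,n,n⟩` (namely the pullback of `groupTensor ℂ G` along `b ↦ s_{b₁}⁻¹ t_{b₂}`,
`c ↦ t_{c₁}⁻¹ u_{c₂}`, `a ↦ s_{a₁}⁻¹ u_{a₂}`) with `R(S) ≤ R(ℂ[G])` whose squared Frobenius distance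
to `⟨n,n,n⟩` is at most (in fact exactly) the number of NON-trivial index solutions of
`(s_{b₁}⁻¹ t_{b₂})(t_{c₁}⁻¹ u_{c₂}) = s_{a₁}⁻¹ u_{a₂}` (trivial = `a₁ = b₁ ∧ b₂ = c₁ ∧ a₂ = c₂`, the
`n³` matrix-multiplication triples, where both tensors are `1`).  [CohnUmans2003, Thm. 2.3 (proof,
p. 5)] — size M, provable now. -/
theorem stub_nearTppRestriction :
    ∀ (G : Type) [Group G] [Fintype G] [DecidableEq G] (n : ℕ) (s t u : Fin n → G),
      ∃ S : Fin n × Fin n → Fin n × Fin n → Fin n × Fin n → ℂ,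
        tensorRank S ≤ tensorRank (groupTensor ℂ G) ∧
        ∑ a, ∑ b, ∑ c, ‖matMulTensor ℂ n n n a b c - S a b c‖ ^ 2 ≤
          ((Finset.univ.filter fun p : (Fin n × Fin n) × (Fin n × Fin n) × (Fin n × Fin n) =>
              (s p.2.1.1)⁻¹ * t p.2.1.2 * ((t p.2.2.1)⁻¹ * u p.2.2.2) = (s p.1.1)⁻¹ * u p.1.2 ∧
                ¬ (p.1.1 = p.2.1.1 ∧ p.2.1.2 = p.2.2.1 ∧ p.1.2 = p.2.2.2)).card : ℝ) := by
  sorry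

/-- **Stub 2 (the load-bearing one): the route crux `GroupSoftness` BY NAME**
(item stmt-MatrixMultiplication-5016, rank 4, open-problem): ONE `η ∈ (0,1)` such that for every
`ε > 0` and all large `n` some finite group `G` with `R(ℂ[G]) ≤ C_ε n^{2+ε}` carries `n`-tuples
`s, t, u` with at most `η n³` non-trivial solutions of the Cohn–Umans equation.
[CohnUmans2003, CohnKleinbergSzegedyUmans2005, arXiv:1207.6528, arXiv:1712.02302] -/
theorem stub_groupSoftness :
    Summit.MatrixMultiplication.MatrixMultiplication.Theses.ApproximationProfile.GroupSoftness := by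
  sorry

/-! ## Assembly (sorry-free) -/

/-- **Assembly**: stub 1 → stub 2 → `Softness` (the crux BY NAME).  Pure bookkeeping: the `η, C, N`
of `GroupSoftness` work verbatim; at `n ≥ N` the near-TPP restriction of the group tensor is the
approximant (`R(S) ≤ R(ℂ[G]) ≤ C n^{2+ε}`, error `≤ #non-trivial ≤ η n³`). -/
theorem Softness_of :
    NearTppRestriction →
    Summit.MatrixMultiplication.MatrixMultiplication.Theses.ApproximationProfile.GroupSoftness →
    Summit.MatrixMultiplication.MatrixMultiplication.Theses.ApproximationProfile.Softness := by
  intro hres hgs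
  obtain ⟨η, hη0, hη1, hfam⟩ := hgs
  refine ⟨η, hη0, hη1, fun ε hε => ?_⟩
  obtain ⟨C, N, hN⟩ := hfam ε hε
  refine ⟨C, N, fun n hn => ?_⟩
  obtain ⟨G, instG, instF, instD, s, t, u, hrank, hcount⟩ := hN n hn
  obtain ⟨S, hS, herr⟩ := hres G n s t u
  refine ⟨S, ?_, herr.trans hcount⟩
  have hS' : (tensorRank S : ℝ) ≤ (tensorRank (groupTensor ℂ G) : ℝ) := by exact_mod_cast hS
  exact hS'.trans hrank

/-- **Registered skeleton conclusion**: the crux `Softness` BY NAME from the two stubs; the only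
`sorry`s of the file sit inside `stub_nearTppRestriction` and `stub_groupSoftness`. -/
theorem Softness_ofStubs :
    Summit.MatrixMultiplication.MatrixMultiplication.Theses.ApproximationProfile.Softness :=
  Softness_of stub_nearTppRestriction stub_groupSoftness

end Summit.MatrixMultiplication.MatrixMultiplication.Cruxes.Softness.Birth
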